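import Summits.CriticalPhenomena.PercolationContinuityZ3.Theorems.PercNearOneGluingNoHeavyLowerTailQuantitativeCshVertexFunLocus
import HarnessLib

/-!
# The CSH margin WITH DECOYS of a vertex functional vanishes when the owner's gate pair into the observer's pocket is not pivotal

Support file (`--supports stmt-CriticalPhenomena-4575`), prover seat `prim-rate-mine-2` (lane prim-rate, constants-miner (c), BENCH row
M2-R41; `run/shared/lean/prim/prim-rate/prim-rate-mine-2/PROOFS.md` §P41).  No definitions, no named facts, no sorries; standard axioms.

Weights supported on `E`; owner `x ∉ Y`, observers `o, v ∉ {x} ∪ Y`, `o ≠ v`; `F` monotone on vertex sets, `f = F ∘ V`.  Suppose the owner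
`x` has an `E`-neighbour `u` in the observer's pocket (`u` joined to `o` by pairs of `E` missing `{x, v} ∪ Y`) and the GATE PAIR `xu` is
NOT `F`-pivotal inside `E_Y`.  Then (Case I of `CSH.cshMargin_nil_pos_iff_exists_pivotal_vertexFun`) `F` is blind to the owner's pocket
`K₁ = comp_u(E_Y − x) ∋ o` (`CSH.apply_diff_eq_of_not_pivotal`), so `covD(f, c) = 0` for every `c ∈ K₁`
(`QuantBHK.covD_eq_zero_of_ownerPocket`); every decoy constant VANISHES on `K₁` for decoys outside `K₁` (a path out of `K₁` leaves through
`x` or `Y`, `QuantBHK.real_avoid_inter_openConn_eq_zero_of_ownerPocket`), hence every level form `sl^j[covD f]` vanishes on `K₁`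
(an induction over the decoy list); and `p_D = 0` unless `v ∈ K₁`.  Therefore

* `CSH.cshMargin_eq_zero_of_gate_not_pivotal` — **`cshMargin w x Y D o v (F ∘ V) = 0` for EVERY decoy list `D`**.

Contrapositive (the form used by the (S5) completeness theorem): if the owner touches the observer's pocket and the margin with decoys is
positive, the gate pair is `F`-pivotal inside `E_Y`.  [cite: VandenbergHaggstromKahn2005, §2.1 (pp. 9–13)] [cite: Grimmett1999, §2.2]
[cite: KozmaNitzan2024, Conj. 1 (p. 3)]
-/

noncomputable section

namespace Summit.CriticalPhenomena.PercolationContinuityZ3.Theorems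

open MeasureTheory Set Literature.Probability.LatticeModels Literature.Probability.Percolation
open scoped Classical
open KNPreFKG

namespace CSH

variable {V : Type*} [Fintype V]

/-- **The CSH margin with decoys vanishes when the gate pair is not pivotal.**  Weights supported on `E`; `x ∉ Y`, `o ∉ {x} ∪ Y`;
`u` joined to `o` by pairs of `E` missing `{x, v} ∪ Y` (in the application `s(x, u) ∈ E` is the gate pair); `F` monotone with
`F(C_x(η ∪ xu)) ≤ F(C_x(η ∖ xu))` for every `η ⊆ E_Y`.  Then `cshMargin w x Y D o v (F ∘ V) = 0` for every decoy list `D` (the level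
forms `sl^j[covD f]` all vanish on the owner's pocket `comp_u(E_Y − x) ∋ o`, and `p_D = 0` unless `v` lies in it).
[cite: VandenbergHaggstromKahn2005, §2.1 (pp. 9–13)] [cite: KozmaNitzan2024, Conj. 1 (p. 3)] -/
theorem cshMargin_eq_zero_of_gate_not_pivotal (w : Sym2 V → unitInterval) (E : Set (Sym2 V))
    (hE0 : ∀ f, f ∉ E → (w f : ℝ) = 0)
    (x : V) (Y : Set V) (o v : V) (hxY : x ∉ Y) (hox : o ≠ x) (hoY : o ∉ Y)
    (u : V) (hu : (openGraph {f | f ∈ E ∧ x ∉ f ∧ v ∉ f ∧ ∀ y ∈ Y, y ∉ f}).Reachable o u)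
    (F : Set V → ℝ) (hF : ∀ S S' : Set V, S ⊆ S' → F S ≤ F S')
    (hnp : ∀ η : Set (Sym2 V), η ⊆ {f | f ∈ E ∧ ∀ y ∈ Y, y ∉ f} →
      F (openCluster (insert s(x, u) η) x) ≤ F (openCluster (η \ {s(x, u)}) x))
    (D : List V) :
    cshMargin w x Y D o v (fun C => F {c | c = x ∨ ∃ e ∈ C, c ∈ e}) = 0 := by
  set μ := prodBernoulli w with hμ
  set f : Set (Sym2 V) → ℝ := fun C => F {c | c = x ∨ ∃ e ∈ C, c ∈ e} with hfdef
  set G₂ : Set (Sym2 V) := {f | f ∈ E ∧ x ∉ f ∧ v ∉ f ∧ ∀ y ∈ Y, y ∉ f} with hG₂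
  set G₁ : Set (Sym2 V) := {f | f ∈ E ∧ x ∉ f ∧ ∀ y ∈ Y, y ∉ f} with hG₁
  set K : Set V := {z | (openGraph G₁).Reachable u z} with hKdef
  have hmeas : ∀ S : Set (BondConfig V), MeasurableSet S := fun _ => MeasurableSet.of_discrete
  have hfx : ∀ ζ : BondConfig V, f (openEdgeCluster ζ x) = F (openCluster ζ x) := by
    intro ζ; simp only [hfdef]; rw [KNPreFKG.openCluster_eq_setOf_openEdgeCluster]
  have hiso : ∀ (S : Set (Sym2 V)) (a d : V), (∀ g ∈ S, a ∉ g) → (openGraph S).Reachable a d → d = a :=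
    fun S a d hS h => QuantBHK.eq_of_reachable_of_forall_notMem hS h
  -- `u ≠ x`, `u ∉ Y`, and the owner's pocket `K ∋ o, u`
  have hux : u ≠ x := fun h => hox (hiso G₂ x o (fun g hg => hg.2.1) (h ▸ hu).symm)
  have huY : u ∉ Y := fun h => hoY ((hiso G₂ u o (fun g hg => hg.2.2.2 u h) hu.symm) ▸ h)
  have hKprop : ∀ z ∈ K, z ≠ x ∧ z ∉ Y := fun z hz =>
    forall_reachable_of_edges (S := G₁) (fun z => z ≠ x ∧ z ∉ Y) ⟨hux, huY⟩
      (fun g hg z hzg => ⟨fun h => hg.2.1 (h ▸ hzg), fun h => hg.2.2 z h hzg⟩) hz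
  have hxK : x ∉ K := fun h => (hKprop x h).1 rfl
  have hYK : ∀ y ∈ Y, y ∉ K := fun y hy h => (hKprop y h).2 hy
  have huK : u ∈ K := SimpleGraph.Reachable.refl u
  have hoK : o ∈ K := hu.symm.mono (BHK2006.openGraph_le fun g hg => ⟨hg.1, hg.2.1, hg.2.2.2⟩)
  have hKstep : ∀ p q : V, s(p, q) ∈ E → p ∈ K → q ∈ K ∨ q = x ∨ q ∈ Y := by
    intro p q hpq hpK
    by_cases hq : q = x ∨ q ∈ Y
    · exact Or.inr hq
    · simp only [not_or] at hq
      left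
      by_cases hpq' : p = q
      · exact hpq' ▸ hpK
      · have hadj : (openGraph G₁).Adj p q := by
          rw [openGraph, SimpleGraph.fromEdgeSet_adj]
          refine ⟨⟨hpq, ?_, ?_⟩, hpq'⟩
          · intro h; rcases Sym2.mem_iff.1 h with h | h; exacts [(hKprop p hpK).1 h.symm, hq.1 h.symm]
          · intro y hy h; rcases Sym2.mem_iff.1 h with h | h; exacts [(hKprop p hpK).2 (h ▸ hy), hq.2 (h ▸ hy)]
        exact SimpleGraph.Reachable.trans hpK hadj.reachable
  have hKconn : ∀ l ∈ K, (openGraph {f | f ∈ E ∧ ∀ z ∈ f, z ∈ K}).Reachable u l := by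
    intro l hl
    obtain ⟨W⟩ := (show (openGraph G₁).Reachable u l from hl)
    refine QuantBHK.reachable_of_walk_edges_subset W fun g hg => ⟨(QuantBHK.mem_and_not_isDiag_of_mem_edges W hg).1.1, fun z hz => ?_⟩
    exact (W.takeUntil z (SimpleGraph.Walk.mem_support_of_mem_edges hg hz)).reachable
  -- `F` is blind to `K`
  have hFK : ∀ ω : Set (Sym2 V), ω ⊆ E → (∀ y ∈ Y, ¬ (openGraph ω).Reachable x y) →
      F (openCluster ω x \ K) = F (openCluster ω x) := fun ω hωE hω =>
    apply_diff_eq_of_not_pivotal E x x u Y K hxK hxK hYK huK hKstep hKconn F hF hnp ω hωE hω (mem_openCluster_self ω x)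
  -- (1) `covD(f, c) = 0` on `K`
  set g : V → ℝ := covD w x Y f with hgdef
  have hgK : ∀ c ∈ K, g c = 0 := by
    intro c hc
    have h := QuantBHK.covD_eq_zero_of_ownerPocket w E hE0 x Y K hxK hYK hxY hKstep F hFK c hc
    simp only [hgdef, covD, hfx]
    rw [h, sub_self]
  -- (2) decoy constants of decoys outside `K` vanish on `K`
  have hcK : ∀ (A : Set V) (d : V), d ∉ K → ∀ z ∈ K, avoidConst w d (insert x Y ∪ A) z = 0 := by
    intro A d hdK z hzK
    have h0 := QuantBHK.real_avoid_inter_openConn_eq_zero_of_ownerPocket w E hE0 x Y K hKstep z d hzK hdK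
    have hle : (prodBernoulli w).real ({ω : BondConfig V | ∀ a ∈ insert x Y ∪ A, ¬ (openGraph ω).Reachable d a} ∩ openConn d z) ≤
        (prodBernoulli w).real ({ω : BondConfig V | ¬ (openGraph ω).Reachable d x ∧ ∀ y ∈ Y, ¬ (openGraph ω).Reachable d y} ∩
          openConn z d) := by
      refine measureReal_mono ?_
      rintro ω ⟨hω, hdz⟩
      exact ⟨⟨hω x (Or.inl (mem_insert x Y)), fun y hy => hω y (Or.inl (mem_insert_of_mem x hy))⟩, SimpleGraph.Reachable.symm hdz⟩
    have hnum : (prodBernoulli w).real ({ω : BondConfig V | ∀ a ∈ insert x Y ∪ A, ¬ (openGraph ω).Reachable d a} ∩ openConn d z) = 0 :=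
      le_antisymm (h0 ▸ hle) measureReal_nonneg
    simp only [avoidConst, hnum, zero_div]
  -- (3) every level form vanishes on `K`; rewrite the decoy list over avoided sets of the form `insert x Y ∪ A`
  have hsl : ∀ (D : List V) (A : Set V) (g' : V → ℝ), (∀ z ∈ K, g' z = 0) →
      ∀ z ∈ K, slForm (decoyList w (insert x Y ∪ A) D) g' z = 0 := by
    intro D
    induction D with
    | nil => intro A g' hg' z hz; simpa [decoyList] using hg' z hz
    | cons d D ih =>
      intro A g' hg' z hz
      rw [decoyList, slForm_cons_eq]
      have hins : insert d (insert x Y ∪ A) = insert x Y ∪ insert d A := by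
        ext t; simp only [mem_insert_iff, mem_union]; tauto
      rw [hins]
      refine ih (insert d A) _ (fun z' hz' => ?_) z hz
      simp only [slStep]
      by_cases hdK : d ∈ K
      · rw [hg' d hdK, mul_zero, sub_zero, hg' z' hz']
      · rw [hcK A d hdK z' hz', zero_mul, sub_zero, hg' z' hz']
  have hslo : slForm (decoyList w (insert x Y) D) g o = 0 := by
    have h := hsl D ∅ g hgK o hoK
    rwa [union_empty] at h
  -- (4) the observers' constant: `p_D = 0` unless `v ∈ K`
  rw [cshMargin, cshMarg, ← hgdef, hslo, zero_sub, neg_eq_zero]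
  by_cases hvK : v ∈ K
  · have h := hsl D ∅ g hgK v hvK
    rw [union_empty] at h
    rw [h, mul_zero]
  · have h0 := QuantBHK.real_avoid_inter_openConn_eq_zero_of_ownerPocket w E hE0 x Y K hKstep o v hoK hvK
    have hle : (prodBernoulli w).real ({ω : BondConfig V | ∀ a ∈ insert x Y ∪ {d | d ∈ D}, ¬ (openGraph ω).Reachable v a} ∩ openConn o v) ≤
        (prodBernoulli w).real ({ω : BondConfig V | ¬ (openGraph ω).Reachable v x ∧ ∀ y ∈ Y, ¬ (openGraph ω).Reachable v y} ∩
          openConn o v) := by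
      refine measureReal_mono ?_
      rintro ω ⟨hω, hov'⟩
      exact ⟨⟨hω x (Or.inl (mem_insert x Y)), fun y hy => hω y (Or.inl (mem_insert_of_mem x hy))⟩, hov'⟩
    have hnum : (prodBernoulli w).real ({ω : BondConfig V | ∀ a ∈ insert x Y ∪ {d | d ∈ D}, ¬ (openGraph ω).Reachable v a} ∩
        openConn o v) = 0 := le_antisymm (h0 ▸ hle) measureReal_nonneg
    simp only [obsConst, hnum, zero_div, zero_mul]

end CSH

end Summit.CriticalPhenomena.PercolationContinuityZ3.Theorems

end
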